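import Summits.QuantumFields.YangMills.Theorems.ColdStartUniversalityLatticeLangevinBatchMeans
import Summits.QuantumFields.YangMills.Theorems.ColdStartUniversalityLatticeLangevinAsymptoticVariance
import HarnessLib

/-!
# Route `ColdStartUniversality` (fixed-cut-off SZZ dynamics): ★★★ THE CENTRED (UNKNOWN-MEAN) BATCH-MEANS ESTIMATOR IS CONSISTENT —
# `E|σ̂²_c − σ²| ≤ √((8b|σ²| + 8K + 2σ⁴)/J + K(2|σ²| + K/b)/b) + |σ²|/J + K/(J²b)`

Helper file (seat `ym-line-csu-p1`, g34; `--supports stmt-QuantumFields-24809`).  File `…BatchMeans` treated the known-mean estimator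
`σ̂² = (Jb)⁻¹Σ_j I_j²`, `I_j = ∫_(jb,(j+1)b] Ĝ(U_r)dr`.  The estimator actually used in practice centres at the OVERALL average:
with block averages `A_j = I_j/b` and `Ā = J⁻¹Σ_j A_j` (the `Ĝ`- and the `G`-versions of `A_j − Ā` coincide, the unknown mean `μ_(β')G` cancels),
`σ̂²_c = (b/J) Σ_j (A_j − Ā)² = σ̂² − b·Ā²`, and `b·E Ā² = b·E[(∫₀^(Jb)Ĝ)²]/(Jb)² ≤ |σ²|/J + K/(J²b)` by the Green–Kubo asymptotics of file 67.  Hence,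
for every strong solution of the SU(2) SZZ dynamics from a deterministic start (progressively measurable form), every continuous `|G| ≤ 1`, `b > 0`,
`J ≥ 1`:
* ★★★ `integral_abs_centredBatchMeans_sub_le_of_prog` — `E|σ̂²_c − σ²| ≤ √((8b|σ²| + 8K + 2σ⁴)/J + K(2|σ²| + K/b)/b) + |σ²|/J + K/(J²b)`.
THEOREMS ONLY, no definition, no sorry; [folklore].  HONEST FRAMING: fixed cut-off; `K` depends on `L, β'`; `UniformColdStartMixing` (24809) is
NOT restated; no crux, rung or summit statement is proved; the Yang–Mills mass gap is NOT proved.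
-/

set_option autoImplicit false

noncomputable section

namespace Summit.QuantumFields.YangMills.Theorems.ColdStartUniversality

open MeasureTheory ProbabilityTheory Filter Topology Set
open scoped NNReal ENNReal BigOperators
open Literature Literature.Probability.Process Literature.MathematicalPhysics.QuantumFieldTheory
open Literature.MathematicalPhysics.QuantumLattice (fundamentalRep fundamentalLatticeRep continuous_fundamentalRep)

variable {L : ℕ} [NeZero L]

/-- ★★★ **Consistency of the CENTRED batch-means estimator** (every coupling; `K` depends on `L, β'`): there is `K ≥ 0` such that for every
realising kernel family, every progressively measurable strong solution from a deterministic start on ANY space, every continuous `|G| ≤ 1`,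
every `b > 0`, `J ≥ 1`, with `I_j = ∫_(jb,(j+1)b] Ĝ(U_r)dr`, `Ā = (Jb)⁻¹Σ_(j<J) I_j`, `σ² = 2∫₀^∞∫Ĝ·κ_tĜ dμ dt`:
`E|(b/J)Σ_(j<J) (I_j/b − Ā)² − σ²| ≤ √((8b|σ²| + 8K + 2σ⁴)/J + K(2|σ²| + K/b)/b) + |σ²|/J + K/(J²b)`. [folklore] -/
theorem integral_abs_centredBatchMeans_sub_le_of_prog (L : ℕ) [NeZero L] (β' : ℝ) :
    ∃ K : ℝ, 0 ≤ K ∧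
      ∀ (κ : ℝ≥0 → Kernel (GaugeConfig 3 L (Matrix.specialUnitaryGroup (Fin 2) ℂ))
          (GaugeConfig 3 L (Matrix.specialUnitaryGroup (Fin 2) ℂ))) [∀ t, IsMarkovKernel (κ t)],
        (∀ (t : ℝ≥0) (x : GaugeConfig 3 L (Matrix.specialUnitaryGroup (Fin 2) ℂ))
          (Ω : Type) [MeasurableSpace Ω] (P : Measure Ω) [IsProbabilityMeasure P]
          (W : ℝ≥0 → Ω → (Edge 3 L × NoiseIdx 2 → ℝ)) (hW : IsFlatBrownian W P)
          (U : ℝ≥0 → Ω → GaugeConfig 3 L (Matrix.specialUnitaryGroup (Fin 2) ℂ)),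
          (∀ ω, U 0 ω = x) →
          (latticeLangevinDynamics (fundamentalLatticeRep 2) β').IsSolution (fundamentalRep (Fin 2))
            hW.natFiltration P W U →
          κ t x = P.map (U t)) →
        ∀ (x : GaugeConfig 3 L (Matrix.specialUnitaryGroup (Fin 2) ℂ))
          (Ω : Type) [MeasurableSpace Ω] (P : Measure Ω) [IsProbabilityMeasure P]
          (W : ℝ≥0 → Ω → (Edge 3 L × NoiseIdx 2 → ℝ)) (hW : IsFlatBrownian W P)
          (U : ℝ≥0 → Ω → GaugeConfig 3 L (Matrix.specialUnitaryGroup (Fin 2) ℂ)),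
          (∀ ω, U 0 ω = x) →
          (latticeLangevinDynamics (fundamentalLatticeRep 2) β').IsSolution (fundamentalRep (Fin 2)) hW.natFiltration P W U →
          (∀ i : ℝ≥0, Measurable[@Prod.instMeasurableSpace (Set.Iic i) Ω inferInstance (hW.natFiltration i)]
            (fun q : Set.Iic i × Ω => U q.1 q.2)) →
        ∀ (G : GaugeConfig 3 L (Matrix.specialUnitaryGroup (Fin 2) ℂ) → ℝ), Continuous G → (∀ z, |G z| ≤ 1) →
        ∀ (b : ℝ), 0 < b → ∀ (J : ℕ), 1 ≤ J →
          ∫ ω, |b / J * (∑ j ∈ Finset.range J,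
              ((∫ r in Ioc ((j : ℝ) * b) (((j : ℝ) + 1) * b), (G (U r.toNNReal ω) - ∫ z, G z ∂(wilsonMeasure (d := 3) (L := L) (fundamentalRep (Fin 2)) β'))) / b -
               ((J : ℝ) * b)⁻¹ * ∑ j' ∈ Finset.range J,
                 (∫ r in Ioc ((j' : ℝ) * b) (((j' : ℝ) + 1) * b), (G (U r.toNNReal ω) - ∫ z, G z ∂(wilsonMeasure (d := 3) (L := L) (fundamentalRep (Fin 2)) β')))) ^ 2) -
              2 * ∫ t in Ioi (0 : ℝ), (∫ y, (G y - ∫ z, G z ∂(wilsonMeasure (d := 3) (L := L) (fundamentalRep (Fin 2)) β')) *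
                (∫ z, (G z - ∫ z', G z' ∂(wilsonMeasure (d := 3) (L := L) (fundamentalRep (Fin 2)) β')) ∂(κ t.toNNReal y))
                ∂(wilsonMeasure (d := 3) (L := L) (fundamentalRep (Fin 2)) β'))| ∂P ≤
            Real.sqrt ((8 * b * |2 * ∫ t in Ioi (0 : ℝ), (∫ y, (G y - ∫ z, G z ∂(wilsonMeasure (d := 3) (L := L) (fundamentalRep (Fin 2)) β')) *
                (∫ z, (G z - ∫ z', G z' ∂(wilsonMeasure (d := 3) (L := L) (fundamentalRep (Fin 2)) β')) ∂(κ t.toNNReal y))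
                ∂(wilsonMeasure (d := 3) (L := L) (fundamentalRep (Fin 2)) β'))| + 8 * K +
              2 * (2 * ∫ t in Ioi (0 : ℝ), (∫ y, (G y - ∫ z, G z ∂(wilsonMeasure (d := 3) (L := L) (fundamentalRep (Fin 2)) β')) *
                (∫ z, (G z - ∫ z', G z' ∂(wilsonMeasure (d := 3) (L := L) (fundamentalRep (Fin 2)) β')) ∂(κ t.toNNReal y))
                ∂(wilsonMeasure (d := 3) (L := L) (fundamentalRep (Fin 2)) β'))) ^ 2) / J +
            K * (2 * |2 * ∫ t in Ioi (0 : ℝ), (∫ y, (G y - ∫ z, G z ∂(wilsonMeasure (d := 3) (L := L) (fundamentalRep (Fin 2)) β')) *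
                (∫ z, (G z - ∫ z', G z' ∂(wilsonMeasure (d := 3) (L := L) (fundamentalRep (Fin 2)) β')) ∂(κ t.toNNReal y))
                ∂(wilsonMeasure (d := 3) (L := L) (fundamentalRep (Fin 2)) β'))| + K / b) / b) +
            |2 * ∫ t in Ioi (0 : ℝ), (∫ y, (G y - ∫ z, G z ∂(wilsonMeasure (d := 3) (L := L) (fundamentalRep (Fin 2)) β')) *
                (∫ z, (G z - ∫ z', G z' ∂(wilsonMeasure (d := 3) (L := L) (fundamentalRep (Fin 2)) β')) ∂(κ t.toNNReal y))
                ∂(wilsonMeasure (d := 3) (L := L) (fundamentalRep (Fin 2)) β'))| / J + K / ((J : ℝ) ^ 2 * b) := by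
  classical
  haveI := secondCountableTopology_su2
  haveI := borelSpace_config L
  obtain ⟨K₁, hK₁, h86⟩ := integral_sq_batchMeans_sub_le_of_prog L β'
  obtain ⟨K₂, hK₂, h67⟩ := abs_integral_sq_centered_sub_greenKubo_le L β'
  set K : ℝ := max K₁ K₂ with hKdef
  have hKK₁ : K₁ ≤ K := le_max_left _ _
  have hKK₂ : K₂ ≤ K := le_max_right _ _
  have hK0 : 0 ≤ K := hK₁.trans hKK₁
  refine ⟨K, hK0, fun κ _ hreal x Ω _ P _ W hW U hU0 hU hprog G hGc hG1 b hb J hJ => ?_⟩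
  set μ : Measure (GaugeConfig 3 L (Matrix.specialUnitaryGroup (Fin 2) ℂ)) :=
    wilsonMeasure (d := 3) (L := L) (fundamentalRep (Fin 2)) β' with hμ
  set m : ℝ := ∫ z, G z ∂μ with hm
  have hG : Measurable G := hGc.measurable
  have hm1 : |m| ≤ 1 := by
    haveI : IsProbabilityMeasure μ :=
      isProbabilityMeasure_wilsonMeasure (d := 3) (L := L) (fundamentalRep (Fin 2)) (continuous_fundamentalRep (Fin 2)) β'
    have hh := norm_integral_le_of_norm_le_const (μ := μ) (f := G) (C := 1)
      (Eventually.of_forall fun z => by simpa [Real.norm_eq_abs] using hG1 z)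
    simpa [Real.norm_eq_abs] using hh
  set Gh : GaugeConfig 3 L (Matrix.specialUnitaryGroup (Fin 2) ℂ) → ℝ := fun z => G z - m with hGh
  have hGhm : Measurable Gh := hG.sub measurable_const
  have hGhb : ∀ z, |Gh z| ≤ 2 := fun z => by
    show |G z - m| ≤ 2
    have := abs_sub (G z) m
    linarith [hG1 z]
  set σ2 : ℝ := 2 * ∫ t in Ioi (0 : ℝ), (∫ y, Gh y * (∫ z, Gh z ∂(κ t.toNNReal y)) ∂μ) with hσ2
  set S : ℝ := |σ2| with hS
  have hJr : (0 : ℝ) < J := by exact_mod_cast hJ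
  have hT : 0 < (J : ℝ) * b := by positivity
  -- joint measurability of the solution
  have hJm : Measurable fun q : Ω × ℝ => U q.2.toNNReal q.1 :=
    measurable_uncurry_of_prog (Z := U) (fun n : ℕ => hW.natFiltration n) (fun n => hW.natFiltration.le n) (fun n => hprog n)
  have hUj : Measurable (Function.uncurry U) := by
    have h3 : Measurable fun p : ℝ≥0 × Ω => (p.2, (p.1 : ℝ)) := measurable_snd.prodMk (measurable_fst.coe_nnreal_real)
    have hfun : (Function.uncurry U) = (fun q : Ω × ℝ => U q.2.toNNReal q.1) ∘ (fun p : ℝ≥0 × Ω => (p.2, (p.1 : ℝ))) := by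
      funext p; simp [Function.uncurry, Real.toNNReal_coe]
    rw [hfun]; exact hJm.comp h3
  have hsec : ∀ ω, Measurable fun r : ℝ => Gh (U r.toNNReal ω) := fun ω => hGhm.comp (hJm.comp (measurable_const.prodMk measurable_id))
  have hii : ∀ ω (a a' : ℝ), IntervalIntegrable (fun r => Gh (U r.toNNReal ω)) volume a a' := fun ω a a' =>
    (intervalIntegrable_const (c := (2 : ℝ))).mono_fun' ((hsec ω).aestronglyMeasurable)
      (ae_of_all _ fun r => by simp only [Real.norm_eq_abs]; exact hGhb _)
  -- the blocks and the total
  set I : ℕ → Ω → ℝ := fun j ω => ∫ r in Ioc ((j : ℝ) * b) (((j : ℝ) + 1) * b), Gh (U r.toNNReal ω) with hI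
  have hIm : ∀ j, Measurable (I j) := fun j => by
    have h1 : Measurable (Function.uncurry fun (ω : Ω) (r : ℝ) => Gh (U r.toNNReal ω)) := hGhm.comp hJm
    exact (h1.stronglyMeasurable.integral_prod_right (ν := volume.restrict (Ioc ((j : ℝ) * b) (((j : ℝ) + 1) * b)))).measurable
  have hjj : ∀ j : ℕ, (j : ℝ) * b ≤ ((j : ℝ) + 1) * b := fun j => by nlinarith
  have hIb : ∀ j ω, |I j ω| ≤ 2 * b := fun j ω => by
    have hh := norm_setIntegral_le_of_norm_le_const (μ := volume) (s := Ioc ((j : ℝ) * b) (((j : ℝ) + 1) * b)) measure_Ioc_lt_top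
      (fun r _ => show ‖Gh (U r.toNNReal ω)‖ ≤ 2 by rw [Real.norm_eq_abs]; exact hGhb _) (f := fun r => Gh (U r.toNNReal ω))
    rw [Real.norm_eq_abs, Real.volume_real_Ioc_of_le (hjj j)] at hh
    calc |I j ω| ≤ 2 * (((j : ℝ) + 1) * b - (j : ℝ) * b) := hh
      _ = 2 * b := by ring
  have htot : ∀ ω, ∑ j ∈ Finset.range J, I j ω = ∫ r in Ioc 0 ((J : ℝ) * b), Gh (U r.toNNReal ω) := by
    intro ω
    have h3 : ∑ j ∈ Finset.range J, ∫ r in ((j : ℝ) * b)..(((j + 1 : ℕ) : ℝ) * b), Gh (U r.toNNReal ω) =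
        ∫ r in (((0 : ℕ) : ℝ) * b)..((J : ℝ) * b), Gh (U r.toNNReal ω) :=
      intervalIntegral.sum_integral_adjacent_intervals (a := fun j : ℕ => (j : ℝ) * b) fun j _ => hii ω _ _
    rw [Nat.cast_zero, zero_mul, intervalIntegral.integral_of_le hT.le] at h3
    rw [← h3]
    refine Finset.sum_congr rfl fun j _ => ?_
    rw [intervalIntegral.integral_of_le (by push_cast; exact hjj j)]
    simp only [hI]; push_cast; rfl
  -- the two ingredients
  have hknown := h86 κ hreal x Ω P W hW U hU0 hU hprog G hGc hG1 b hb J hJ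
  have hGK := h67 κ hreal x Ω P W hW U hU0 hU hUj G hGc hG1 ((J : ℝ) * b) hT.le
  -- abbreviations
  set Vk : Ω → ℝ := fun ω => ((J : ℝ) * b)⁻¹ * (∑ j ∈ Finset.range J, I j ω ^ 2) - σ2 with hVk
  set Abar : Ω → ℝ := fun ω => ((J : ℝ) * b)⁻¹ * ∑ j ∈ Finset.range J, I j ω with hAbar
  -- algebra: centred estimator = known-mean estimator − b Ā²
  have halg : ∀ ω, b / J * (∑ j ∈ Finset.range J, (I j ω / b - Abar ω) ^ 2) - σ2 = Vk ω - b * Abar ω ^ 2 := by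
    intro ω
    have hsumA : ∑ j ∈ Finset.range J, I j ω / b = J * Abar ω := by
      simp only [hAbar]; rw [← Finset.sum_div]; field_simp
    have hexp : ∑ j ∈ Finset.range J, (I j ω / b - Abar ω) ^ 2 =
        (∑ j ∈ Finset.range J, (I j ω / b) ^ 2) - 2 * Abar ω * (∑ j ∈ Finset.range J, I j ω / b) + J * Abar ω ^ 2 := by
      have : ∀ j ∈ Finset.range J, (I j ω / b - Abar ω) ^ 2 = (I j ω / b) ^ 2 - 2 * Abar ω * (I j ω / b) + Abar ω ^ 2 := fun j _ => by ring
      rw [Finset.sum_congr rfl this, Finset.sum_add_distrib, Finset.sum_sub_distrib, ← Finset.mul_sum, Finset.sum_const, Finset.card_range,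
        nsmul_eq_mul]
    rw [hexp, hsumA]
    simp only [hVk]
    have hsq : ∑ j ∈ Finset.range J, (I j ω / b) ^ 2 = (∑ j ∈ Finset.range J, I j ω ^ 2) / b ^ 2 := by
      rw [Finset.sum_div]; exact Finset.sum_congr rfl fun j _ => by ring
    rw [hsq]
    field_simp
    ring
  -- integrability
  have hSm : Measurable fun ω => ∑ j ∈ Finset.range J, I j ω := Finset.measurable_sum _ fun j _ => hIm j
  have hSb : ∀ ω, |∑ j ∈ Finset.range J, I j ω| ≤ J * (2 * b) := fun ω =>
    (Finset.abs_sum_le_sum_abs _ _).trans (by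
      calc ∑ j ∈ Finset.range J, |I j ω| ≤ ∑ _j ∈ Finset.range J, 2 * b := Finset.sum_le_sum fun j _ => hIb j ω
        _ = J * (2 * b) := by rw [Finset.sum_const, Finset.card_range, nsmul_eq_mul])
  have hAm : Measurable Abar := hSm.const_mul _
  have hAb : ∀ ω, |Abar ω| ≤ 2 := fun ω => by
    simp only [hAbar]; rw [abs_mul, abs_inv, abs_of_pos hT]
    calc ((J : ℝ) * b)⁻¹ * |∑ j ∈ Finset.range J, I j ω| ≤ ((J : ℝ) * b)⁻¹ * (J * (2 * b)) := mul_le_mul_of_nonneg_left (hSb ω) (by positivity)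
      _ = 2 := by field_simp
  have hS2m : Measurable fun ω => ∑ j ∈ Finset.range J, I j ω ^ 2 := Finset.measurable_sum _ fun j _ => (hIm j).pow_const 2
  have hVm : Measurable Vk := (hS2m.const_mul _).sub measurable_const
  have hVb : ∀ ω, |Vk ω| ≤ 4 * b + S := fun ω => by
    simp only [hVk]
    refine (abs_sub _ _).trans (add_le_add ?_ le_rfl)
    rw [abs_mul, abs_inv, abs_of_pos hT]
    have h1 : |∑ j ∈ Finset.range J, I j ω ^ 2| ≤ J * (4 * b ^ 2) := by
      rw [abs_of_nonneg (Finset.sum_nonneg fun j _ => sq_nonneg _)]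
      calc ∑ j ∈ Finset.range J, I j ω ^ 2 ≤ ∑ _j ∈ Finset.range J, 4 * b ^ 2 := Finset.sum_le_sum fun j _ => by
            have := hIb j ω; rw [← sq_abs]; nlinarith [abs_nonneg (I j ω)]
        _ = J * (4 * b ^ 2) := by rw [Finset.sum_const, Finset.card_range, nsmul_eq_mul]
    calc ((J : ℝ) * b)⁻¹ * |∑ j ∈ Finset.range J, I j ω ^ 2| ≤ ((J : ℝ) * b)⁻¹ * (J * (4 * b ^ 2)) := mul_le_mul_of_nonneg_left h1 (by positivity)
      _ = 4 * b := by field_simp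
  have hVi : Integrable (fun ω => |Vk ω|) P := ((integrable_const (4 * b + S)).mono' hVm.aestronglyMeasurable
    (Eventually.of_forall fun ω => by rw [Real.norm_eq_abs]; exact hVb ω)).abs
  have hA2i : Integrable (fun ω => b * Abar ω ^ 2) P := ((integrable_const (2 * 2)).mono' (hAm.pow_const 2).aestronglyMeasurable
    (Eventually.of_forall fun ω => by
      rw [Real.norm_eq_abs, abs_of_nonneg (sq_nonneg _), sq, ← abs_mul_abs_self]
      exact mul_le_mul (hAb ω) (hAb ω) (abs_nonneg _) zero_le_two)).const_mul b
  -- `E|V_c − σ²| ≤ E|V_known − σ²| + b E Ā²`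
  have hstep : ∫ ω, |b / J * (∑ j ∈ Finset.range J, (I j ω / b - Abar ω) ^ 2) - σ2| ∂P ≤ (∫ ω, |Vk ω| ∂P) + ∫ ω, b * Abar ω ^ 2 ∂P := by
    rw [← integral_add hVi hA2i]
    refine integral_mono_of_nonneg (Eventually.of_forall fun ω => abs_nonneg _) (hVi.add hA2i) (Eventually.of_forall fun ω => ?_)
    show |b / J * (∑ j ∈ Finset.range J, (I j ω / b - Abar ω) ^ 2) - σ2| ≤ |Vk ω| + b * Abar ω ^ 2
    rw [halg ω]
    have h0 : 0 ≤ b * Abar ω ^ 2 := by positivity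
    calc |Vk ω - b * Abar ω ^ 2| ≤ |Vk ω| + |b * Abar ω ^ 2| := abs_sub _ _
      _ = |Vk ω| + b * Abar ω ^ 2 := by rw [abs_of_nonneg h0]
  -- first term: Cauchy–Schwarz + file 86 (monotone in `K`)
  have h1 : ∫ ω, |Vk ω| ∂P ≤ Real.sqrt ((8 * b * S + 8 * K + 2 * σ2 ^ 2) / J + K * (2 * S + K / b) / b) := by
    have hmem : MemLp Vk 2 P := MemLp.of_bound hVm.aestronglyMeasurable (4 * b + S) (ae_of_all _ fun ω => by
      rw [Real.norm_eq_abs]; exact hVb ω)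
    refine (integral_abs_le_sqrt_integral_sq hmem).trans (Real.sqrt_le_sqrt (hknown.trans ?_))
    have hS0 : 0 ≤ S := abs_nonneg _
    gcongr
  -- second term: `b E Ā² = b E[(∫₀ᵀ Ĝ)²]/T² ≤ |σ²|/J + K/(J² b)`
  have h2 : ∫ ω, b * Abar ω ^ 2 ∂P ≤ S / J + K / ((J : ℝ) ^ 2 * b) := by
    have heq : ∫ ω, b * Abar ω ^ 2 ∂P = b * ((J : ℝ) * b)⁻¹ ^ 2 * ∫ ω, (∫ r in Ioc 0 ((J : ℝ) * b), Gh (U r.toNNReal ω)) ^ 2 ∂P := by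
      rw [← integral_const_mul]
      exact integral_congr_ae (ae_of_all _ fun ω => by simp only [hAbar]; rw [htot ω]; ring)
    rw [heq]
    have hE : ∫ ω, (∫ r in Ioc 0 ((J : ℝ) * b), Gh (U r.toNNReal ω)) ^ 2 ∂P ≤ S * ((J : ℝ) * b) + K := by
      have := (abs_sub_le_iff.1 hGK).1
      have h3 : 2 * ((J : ℝ) * b) * (∫ t in Ioi (0 : ℝ), (∫ y, Gh y * (∫ z, Gh z ∂(κ t.toNNReal y)) ∂μ)) = σ2 * ((J : ℝ) * b) := by rw [hσ2]; ring
      rw [h3] at this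
      have h4 : σ2 * ((J : ℝ) * b) ≤ S * ((J : ℝ) * b) := mul_le_mul_of_nonneg_right (le_abs_self _) hT.le
      linarith
    calc b * ((J : ℝ) * b)⁻¹ ^ 2 * ∫ ω, (∫ r in Ioc 0 ((J : ℝ) * b), Gh (U r.toNNReal ω)) ^ 2 ∂P
        ≤ b * ((J : ℝ) * b)⁻¹ ^ 2 * (S * ((J : ℝ) * b) + K) := mul_le_mul_of_nonneg_left hE (by positivity)
      _ = S / J + K / ((J : ℝ) ^ 2 * b) := by field_simp
  exact hstep.trans (by linarith [h1, h2])

end Summit.QuantumFields.YangMills.Theorems.ColdStartUniversality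

end
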